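import Mathlib
import HarnessLib
import Literature.Analysis.FluidPDE.SwirlMaximumPrinciple
import Literature.Analysis.FluidPDE.NSWave0
import Literature.Analysis.FluidPDE.TaoLocalisationHolds
import Literature.Analysis.FluidPDE.TaoLocalisationProofs
import Literature.Analysis.FluidPDE.VectorCalculus

/-!
# No swirling profile for an axisymmetric frozen-eddy collapse (crux stmt-NavierStokesRegularity-1430)

Route AdiabaticEddy, crux `FrozenEddyCollapse` (stmt-1430) / kill `NoFrozenEddyCollapse` (stmt-1431).
Ideator 2's barrier note BN2 (`Cruxes/FrozenEddyCollapse/NegativeNotes-ideator2.md`, typed there as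
`Ideator2.NoAxisymmetricFrozenEddyCollapse`), made a theorem.  The swirl maximum principle of the tree
needs the velocity bounded on every closed sub-slab `[0, T'] × ℝ³`, `T' < T`; for a classical solution
that is Leray–Hopf from a rapidly decaying datum (the crux's own hypotheses) this is DISCHARGED here
from Tao 2013 (Cor. 11.1 + Thm. 5.4 (iv), in tree `tao2011_hasBoundedSobolevNormsOn_holds`) and the
Sobolev imbedding `H² ⊂ L^∞` (`linfty_bound_of_hasBoundedSobolevNormsOn_holds`), so the final
statement `noSwirl_of_axisymmetric_frozenEddyCollapse` carries exactly the hypotheses of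
`NoFrozenEddyCollapse` plus axisymmetry of the slices and an on-axis centre path:

if a classical solution on `[0, T)`, Leray–Hopf from a rapidly decaying datum, is AXISYMMETRIC (about
the `x₂`-axis) and its renormalisation `(T - t)^α • u t (ξ t + ℓ√(ν(T - t)) • y)` with `α > 1/2` and an
ON-AXIS centre path `ξ` converges (pointwise in `y` suffices) to a profile `U`, then `U` is axisymmetric
and swirl-free (`IsAxisymmetric U ∧ HasNoSwirl U`).

Mechanism (KNSS 2009 (1.9) / Lei–Zhang 2017 (1.4), in tree as `abs_swirl_le_of_classical`): the swirl
`Γ = x₀u₁ − x₁u₀` obeys `|Γ(t, x)| ≤ sup|Γ₀| =: M`, while along the renormalisation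
`(T - t)^α Γ(t, ξ t + L y) = L · (y₀ F₁ − y₁ F₀)(t)` with `L = ℓ√(ν(T - t))` and `F t → U y`; hence
`|y₀ F₁ − y₁ F₀| ≤ M (T - t)^α / L ∝ (T - t)^{α − 1/2} → 0`, i.e. `swirl U y = 0`: the eddy's
circulation scale `A·L = (T - t)^{1/2 − α} ℓ√ν → ∞` is exactly what the maximum principle forbids.

* `tendsto_rpow_sub_half_nhdsLT` — `(T - t)^{α − 1/2} → 0` as `t ↑ T` (`α > 1/2`).
* `exists_abs_swirl_le_of_hasRapidSpatialDecay` — a rapidly decaying datum has bounded swirl.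
* `abs_swirl_le_of_classical_Ico` — the maximum principle on the half-open lifespan `[0, T)`.
* `swirl_profile_eq_zero_of_axisymmetric` — the pointwise statement; `hasNoSwirl_profile_of_axisymmetric`
  — BN2 in the crux's vocabulary (locally uniform convergence, `α ∈ (1/2, 3/4)`).
* `isAxisymmetric_profile_of_axisymmetric` — axisymmetry passes to the pointwise limit profile.
* `bounded_subslab_of_lerayHopf` — the sub-slab `L^∞` bound from Leray–Hopf + rapid decay (Tao).
* `noSwirl_of_axisymmetric_frozenEddyCollapse` — the packaged statement in the hypotheses of
  `NoFrozenEddyCollapse` + axisymmetry + on-axis centre.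
-/

noncomputable section

-- the summit-side namespace repeats a component by design (D-0017)
set_option linter.dupNamespace false

namespace Summit.NavierStokesRegularity.NavierStokesRegularity.Cruxes.FrozenEddyCollapse.LeadAll

open Filter Topology Set
open Literature.Analysis.FluidPDE

local notation "ℝ³" => EuclideanSpace ℝ (Fin 3)

/-- `(T - t)^{q} → 0` as `t ↑ T` for `q > 0` (continuity of `s ↦ s^q` at `0`, `0^q = 0`). [folklore] -/
theorem tendsto_rpow_nhdsLT_zero {T q : ℝ} (hq : 0 < q) :
    Tendsto (fun t : ℝ => (T - t) ^ q) (𝓝[<] T) (𝓝 0) := by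
  have hsub : Tendsto (fun t : ℝ => T - t) (𝓝[<] T) (𝓝 0) := by
    have hc : Tendsto (fun t : ℝ => T - t) (𝓝 T) (𝓝 (T - T)) :=
      (continuous_const.sub continuous_id).tendsto T
    rw [sub_self] at hc
    exact hc.mono_left nhdsWithin_le_nhds
  have hc0 : ContinuousAt (fun s : ℝ => s ^ q) 0 := Real.continuousAt_rpow_const 0 q (Or.inr hq.le)
  have h0 : Tendsto (fun t : ℝ => (T - t) ^ q) (𝓝[<] T) (𝓝 ((0 : ℝ) ^ q)) := hc0.tendsto.comp hsub
  rwa [Real.zero_rpow hq.ne'] at h0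

/-- **A rapidly decaying datum has bounded swirl**: Fefferman's decay (4) with `n = 0`, `K = 1`
gives `(1 + ‖x‖)‖u₀ x‖ ≤ C`, and `|Γ₀(x)| ≤ 2‖x‖‖u₀ x‖ ≤ 2C` (`abs_swirl_le_norm_mul`). [folklore] -/
theorem exists_abs_swirl_le_of_hasRapidSpatialDecay {u₀ : ℝ³ → ℝ³} (h : HasRapidSpatialDecay u₀) :
    ∃ M : ℝ, ∀ x, |swirl u₀ x| ≤ M := by
  obtain ⟨C, hC⟩ := h 0 1
  refine ⟨2 * C, fun x => ?_⟩
  have hx : (1 + ‖x‖) * ‖u₀ x‖ ≤ C := by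
    simpa [norm_iteratedFDeriv_zero] using hC x
  calc |swirl u₀ x| ≤ 2 * ‖x‖ * ‖u₀ x‖ := abs_swirl_le_norm_mul u₀ x
    _ ≤ 2 * ((1 + ‖x‖) * ‖u₀ x‖) := by
        nlinarith [norm_nonneg x, norm_nonneg (u₀ x)]
    _ ≤ 2 * C := by linarith

/-- **Swirl maximum principle on the half-open lifespan.** For a classical solution (`ν > 0`) on
`[0, T)` with axisymmetric slices, velocity bounded on every closed sub-slab `[0, T']`, `T' < T`, and
`|Γ₀| ≤ M`, one has `|Γ(t, x)| ≤ M` for all `t ∈ [0, T)` (apply `abs_swirl_le_of_classical` on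
`[0, (t + T)/2]`; Lei–Zhang 2017, (1.4); KNSS 2009, (1.9)). [cite: LeiZhang2017, §1 (1.4) (arXiv p. 3)] -/
theorem abs_swirl_le_of_classical_Ico {T ν M : ℝ} {u : ℝ → ℝ³ → ℝ³} {p : ℝ → ℝ³ → ℝ}
    (hν : 0 < ν) (hcl : IsClassicalNSSolutionOn (Ico 0 T) ν 0 u p)
    (haxi : ∀ t ∈ Ico 0 T, IsAxisymmetric (u t))
    (hbdd : ∀ T' ∈ Ioo 0 T, ∃ V : ℝ, ∀ t ∈ Icc 0 T', ∀ x, ‖u t x‖ ≤ V)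
    (hM : ∀ x, |swirl (u 0) x| ≤ M) :
    ∀ t ∈ Ico 0 T, ∀ x, |swirl (u t) x| ≤ M := by
  intro t ht x
  set T' : ℝ := (t + T) / 2 with hT'
  have hT'pos : 0 < T' := by rw [hT']; linarith [ht.1, ht.2]
  have hT'T : T' < T := by rw [hT']; linarith [ht.2]
  have htT' : t ≤ T' := by rw [hT']; linarith [ht.2]
  have hsub : Icc 0 T' ⊆ Ico 0 T := fun s hs => ⟨hs.1, hs.2.trans_lt hT'T⟩
  have hcl' : IsClassicalNSSolutionOn (Icc 0 T') ν 0 u p := hcl.mono hsub (uniqueDiffOn_Icc hT'pos)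
  obtain ⟨V, hV⟩ := hbdd T' ⟨hT'pos, hT'T⟩
  exact abs_swirl_le_of_classical hν hT'pos hcl' (fun s hs => haxi s (hsub hs)) hV hM t ⟨ht.1, htT'⟩ x

/-- **The frozen profile of an axisymmetric collapse has no swirl at `y` (pointwise form).**
Classical solution on `[0, T)` (`ν > 0`, `T > 0`), axisymmetric slices, velocity bounded on closed
sub-slabs, bounded initial swirl; if `(T - t)^α • u t (ξ t + (ℓ√(ν(T - t))) • y) → v` as `t ↑ T` with
`α > 1/2`, `ℓ > 0` and `ξ t` on the axis, then `y₀ v₁ − y₁ v₀ = 0`. [folklore] -/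
theorem swirl_profile_eq_zero_of_axisymmetric {T ν α ℓ : ℝ} {u : ℝ → ℝ³ → ℝ³} {p : ℝ → ℝ³ → ℝ}
    (hν : 0 < ν) (hT : 0 < T) (hcl : IsClassicalNSSolutionOn (Ico 0 T) ν 0 u p)
    (haxi : ∀ t ∈ Ico 0 T, IsAxisymmetric (u t))
    (hbdd : ∀ T' ∈ Ioo 0 T, ∃ V : ℝ, ∀ t ∈ Icc 0 T', ∀ x, ‖u t x‖ ≤ V)
    (hM : ∃ M : ℝ, ∀ x, |swirl (u 0) x| ≤ M) (hα : 1 / 2 < α) (hℓ : 0 < ℓ)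
    {ξ : ℝ → ℝ³} (hξ : ∀ t, ξ t 0 = 0 ∧ ξ t 1 = 0) {y v : ℝ³}
    (hconv : Tendsto (fun t => ((T - t) ^ α) • u t (ξ t + (ℓ * Real.sqrt (ν * (T - t))) • y))
      (𝓝[<] T) (𝓝 v)) :
    y 0 * v 1 - y 1 * v 0 = 0 := by
  obtain ⟨M, hM⟩ := hM
  have hΓ := abs_swirl_le_of_classical_Ico hν hcl haxi hbdd hM
  -- notation
  set L : ℝ → ℝ := fun t => ℓ * Real.sqrt (ν * (T - t)) with hL
  set x : ℝ → ℝ³ := fun t => ξ t + (L t) • y with hx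
  set F : ℝ → ℝ³ := fun t => ((T - t) ^ α) • u t (x t) with hF
  set G : ℝ → ℝ := fun t => y 0 * F t 1 - y 1 * F t 0 with hG
  -- `G t → y₀ v₁ − y₁ v₀`
  have hconvF : Tendsto F (𝓝[<] T) (𝓝 v) := hconv
  have hG1 : Tendsto G (𝓝[<] T) (𝓝 (y 0 * v 1 - y 1 * v 0)) := by
    have h1 : Tendsto (fun t => F t 1) (𝓝[<] T) (𝓝 (v 1)) :=
      ((PiLp.continuous_apply 2 _ 1).tendsto v).comp hconvF
    have h0 : Tendsto (fun t => F t 0) (𝓝[<] T) (𝓝 (v 0)) :=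
      ((PiLp.continuous_apply 2 _ 0).tendsto v).comp hconvF
    exact (h1.const_mul (y 0)).sub (h0.const_mul (y 1))
  -- the swirl identity along the renormalisation: `(T - t)^α Γ(t, x t) = L t * G t`
  have hswirl : ∀ t, (T - t) ^ α * swirl (u t) (x t) = L t * G t := by
    intro t
    have hx0 : x t 0 = L t * y 0 := by
      simp only [hx, PiLp.add_apply, PiLp.smul_apply, smul_eq_mul, (hξ t).1, zero_add]
    have hx1 : x t 1 = L t * y 1 := by
      simp only [hx, PiLp.add_apply, PiLp.smul_apply, smul_eq_mul, (hξ t).2, zero_add]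
    have hF0 : F t 0 = (T - t) ^ α * u t (x t) 0 := by
      simp only [hF, PiLp.smul_apply, smul_eq_mul]
    have hF1 : F t 1 = (T - t) ^ α * u t (x t) 1 := by
      simp only [hF, PiLp.smul_apply, smul_eq_mul]
    simp only [swirl, hG, hx0, hx1, hF0, hF1]
    ring
  -- `G t → 0`: `|G t| ≤ (M / (ℓ √ν)) (T - t)^{α - 1/2}` for `t ∈ [0, T)`
  have hG0 : Tendsto G (𝓝[<] T) (𝓝 0) := by
    have hbound : ∀ᶠ t in 𝓝[<] T, ‖G t‖ ≤ M / (ℓ * Real.sqrt ν) * (T - t) ^ (α - 1 / 2) := by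
      filter_upwards [Ico_mem_nhdsLT hT] with t ht
      have hTt : 0 < T - t := sub_pos.2 ht.2
      have hsqν : 0 < Real.sqrt ν := Real.sqrt_pos.2 hν
      have hLt : L t = ℓ * Real.sqrt ν * (T - t) ^ (1 / 2 : ℝ) := by
        simp only [hL]
        rw [Real.sqrt_mul hν.le, Real.sqrt_eq_rpow (T - t)]
        ring
      have hLpos : 0 < L t := by
        rw [hLt]; exact mul_pos (mul_pos hℓ hsqν) (Real.rpow_pos_of_pos hTt _)
      have h1 : |L t * G t| ≤ (T - t) ^ α * M := by
        rw [← hswirl t, abs_mul, abs_of_nonneg (Real.rpow_nonneg hTt.le α)]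
        exact mul_le_mul_of_nonneg_left (hΓ t ht (x t)) (Real.rpow_nonneg hTt.le α)
      rw [abs_mul, abs_of_pos hLpos] at h1
      have h2 : |G t| ≤ (T - t) ^ α * M / L t := by
        rw [le_div_iff₀ hLpos]; linarith
      have h3 : (T - t) ^ α * M / L t = M / (ℓ * Real.sqrt ν) * (T - t) ^ (α - 1 / 2) := by
        rw [hLt, Real.rpow_sub hTt]
        field_simp
      rw [Real.norm_eq_abs]
      linarith [h2, h3.le, h3.ge]
    have hlim : Tendsto (fun t => M / (ℓ * Real.sqrt ν) * (T - t) ^ (α - 1 / 2)) (𝓝[<] T) (𝓝 0) := by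
      simpa using (tendsto_rpow_nhdsLT_zero (T := T) (by linarith : 0 < α - 1 / 2)).const_mul
        (M / (ℓ * Real.sqrt ν))
    exact squeeze_zero_norm' hbound hlim
  exact tendsto_nhds_unique hG1 hG0

/-- **No swirling profile for an axisymmetric frozen-eddy collapse (BN2 of the crux notes, with the
boundedness hypothesis the maximum principle needs).** Let `(u, p)` be a classical solution of
unforced Navier–Stokes (`ν > 0`) on `ℝ³ × [0, T)` from a rapidly decaying datum, axisymmetric about the
`x₂`-axis, with velocity bounded on every `[0, T'] × ℝ³`, `T' < T`.  If for some `α ∈ (1/2, 3/4)`,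
`ℓ > 0` and an on-axis centre path `ξ` the renormalised field
`(T - t)^α • u t (ξ t + ℓ√(ν(T - t)) • y)` converges locally uniformly to `U` as `t ↑ T` (the clause of
`AdiabaticEddy.FrozenEddyCollapse` / `NoFrozenEddyCollapse`), then `HasNoSwirl U`: a swirling frozen
eddy needs a circulation scale `A·L → ∞`, forbidden by the swirl maximum principle
(KNSS 2009 (1.9); Lei–Zhang 2017 (1.4)). [folklore] -/
theorem hasNoSwirl_profile_of_axisymmetric {T ν : ℝ} (hν : 0 < ν) (hT : 0 < T)
    {u : ℝ → ℝ³ → ℝ³} {p : ℝ → ℝ³ → ℝ} (hcl : IsClassicalNSSolutionOn (Ico 0 T) ν 0 u p)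
    (hdec : HasRapidSpatialDecay (u 0)) (haxi : ∀ t ∈ Ico 0 T, IsAxisymmetric (u t))
    (hbdd : ∀ T' ∈ Ioo 0 T, ∃ V : ℝ, ∀ t ∈ Icc 0 T', ∀ x, ‖u t x‖ ≤ V)
    {U : ℝ³ → ℝ³} {α : ℝ} (hα : α ∈ Ioo (1 / 2 : ℝ) (3 / 4)) {ℓ : ℝ} (hℓ : 0 < ℓ)
    {ξ : ℝ → ℝ³} (hξ : ∀ t, ξ t 0 = 0 ∧ ξ t 1 = 0)
    (hconv : TendstoLocallyUniformly
      (fun (t : ℝ) (y : ℝ³) => ((T - t) ^ α) • u t (ξ t + (ℓ * Real.sqrt (ν * (T - t))) • y)) U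
      (𝓝[<] T)) :
    HasNoSwirl U := by
  intro y
  exact swirl_profile_eq_zero_of_axisymmetric hν hT hcl haxi hbdd
    (exists_abs_swirl_le_of_hasRapidSpatialDecay hdec) hα.1 hℓ hξ
    (hconv.tendstoLocallyUniformlyOn.tendsto_at (mem_univ y))

/-- A point of the axis is fixed by every rotation `R_θ`. [folklore] -/
theorem rotZ_eq_self_of_onAxis {ξ : ℝ³} (h0 : ξ 0 = 0) (h1 : ξ 1 = 0) (θ : ℝ) : rotZ θ ξ = ξ := by
  ext i
  fin_cases i
  · simp [rotZ, h0, h1]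
  · simp [rotZ, h0, h1]
  · simp [rotZ]

/-- **The frozen profile of an axisymmetric collapse is axisymmetric.** If the slices `u t`,
`t ∈ [0, T)`, are axisymmetric and the centre path lies on the axis, every pointwise limit `U` of the
renormalisation `(T - t)^α • u t (ξ t + L(t) • y)` as `t ↑ T` is axisymmetric: the renormalised
slices are axisymmetric (`R_θ` is linear, fixes `ξ t`, and commutes with `u t`) and axisymmetry is
closed under pointwise limits (`R_θ` continuous). No equation is used. [folklore] -/
theorem isAxisymmetric_profile_of_axisymmetric {T α : ℝ} (hT : 0 < T) {u : ℝ → ℝ³ → ℝ³}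
    (haxi : ∀ t ∈ Ico 0 T, IsAxisymmetric (u t)) {L : ℝ → ℝ} {ξ : ℝ → ℝ³}
    (hξ : ∀ t, ξ t 0 = 0 ∧ ξ t 1 = 0) {U : ℝ³ → ℝ³}
    (hconv : ∀ y, Tendsto (fun t => ((T - t) ^ α) • u t (ξ t + (L t) • y)) (𝓝[<] T) (𝓝 (U y))) :
    IsAxisymmetric U := by
  intro θ y
  have h1 : Tendsto (fun t => ((T - t) ^ α) • u t (ξ t + (L t) • rotZ θ y)) (𝓝[<] T)
      (𝓝 (U (rotZ θ y))) := hconv (rotZ θ y)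
  have h2 : Tendsto (fun t => rotZ θ (((T - t) ^ α) • u t (ξ t + (L t) • y))) (𝓝[<] T)
      (𝓝 (rotZ θ (U y))) :=
    ((rotZL θ).continuous.tendsto (U y)).comp (hconv y)
  have heq : ∀ᶠ t in 𝓝[<] T, rotZ θ (((T - t) ^ α) • u t (ξ t + (L t) • y)) =
      ((T - t) ^ α) • u t (ξ t + (L t) • rotZ θ y) := by
    filter_upwards [Ico_mem_nhdsLT hT] with t ht
    have hx : rotZ θ (ξ t + (L t) • y) = ξ t + (L t) • rotZ θ y := by
      rw [← rotZL_apply, map_add, map_smul, rotZL_apply, rotZL_apply,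
        rotZ_eq_self_of_onAxis (hξ t).1 (hξ t).2]
    rw [← rotZL_apply, map_smul, rotZL_apply, ← haxi t ht, hx]
  exact tendsto_nhds_unique h1 (h2.congr' heq)

/-- **Axisymmetric frozen-eddy collapse: the profile is axisymmetric AND swirl-free.** Packaging of
`isAxisymmetric_profile_of_axisymmetric` and `hasNoSwirl_profile_of_axisymmetric` in the vocabulary of
`AdiabaticEddy.NoFrozenEddyCollapse` restricted to axisymmetric solutions with on-axis centre (plus the
sub-slab boundedness the maximum principle needs). What remains of the axisymmetric case of the kill
crux stmt-NavierStokesRegularity-1431 is therefore the steady statement "a smooth compactly supported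
axisymmetric swirl-free steady Euler flow vanishes" (Jiu–Xin; not in the tree). [folklore] -/
theorem axisymmetric_frozenEddy_profile {T ν : ℝ} (hν : 0 < ν) (hT : 0 < T)
    {u : ℝ → ℝ³ → ℝ³} {p : ℝ → ℝ³ → ℝ} (hcl : IsClassicalNSSolutionOn (Ico 0 T) ν 0 u p)
    (hdec : HasRapidSpatialDecay (u 0)) (haxi : ∀ t ∈ Ico 0 T, IsAxisymmetric (u t))
    (hbdd : ∀ T' ∈ Ioo 0 T, ∃ V : ℝ, ∀ t ∈ Icc 0 T', ∀ x, ‖u t x‖ ≤ V)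
    {U : ℝ³ → ℝ³} {α : ℝ} (hα : α ∈ Ioo (1 / 2 : ℝ) (3 / 4)) {ℓ : ℝ} (hℓ : 0 < ℓ)
    {ξ : ℝ → ℝ³} (hξ : ∀ t, ξ t 0 = 0 ∧ ξ t 1 = 0)
    (hconv : TendstoLocallyUniformly
      (fun (t : ℝ) (y : ℝ³) => ((T - t) ^ α) • u t (ξ t + (ℓ * Real.sqrt (ν * (T - t))) • y)) U
      (𝓝[<] T)) :
    IsAxisymmetric U ∧ HasNoSwirl U :=
  ⟨isAxisymmetric_profile_of_axisymmetric hT haxi hξ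
      (fun y => hconv.tendstoLocallyUniformlyOn.tendsto_at (mem_univ y)),
    hasNoSwirl_profile_of_axisymmetric hν hT hcl hdec haxi hbdd hα hℓ hξ hconv⟩

open scoped ENNReal in
/-- **Sub-slab boundedness of the physical solution** (the hypothesis of the maximum principle,
discharged): a classical solution of the unforced system (`ν > 0`) on `ℝ³ × [0, T)` which is
Leray–Hopf from a rapidly decaying datum is bounded on every closed sub-slab `[0, T'] × ℝ³`,
`0 < T' < T`.  The energy on `[0, T']` is bounded by the initial energy
(`IsLerayHopfOn.lintegral_enorm_sq_le`), so all Sobolev norms are bounded there (Tao 2013,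
Cor. 11.1 + Cor. 4.3 + Thm. 5.4 (iv): `tao2011_hasBoundedSobolevNormsOn_holds`) and `H² ⊂ L^∞`
(Adams–Fournier Thm. 4.12: `linfty_bound_of_hasBoundedSobolevNormsOn_holds`).  Same chain as the
tree's `hasBoundedSobolevNormsOn_subslab`; restated to keep this module's imports light. [cite: Tao2011, Cor. 11.1 + Cor. 4.3 + Thm. 5.4 (iv)] -/
theorem bounded_subslab_of_lerayHopf {T ν : ℝ} (hν : 0 < ν) {u : ℝ → ℝ³ → ℝ³} {p : ℝ → ℝ³ → ℝ}
    (hcl : IsClassicalNSSolutionOn (Ico 0 T) ν 0 u p) (hLH : IsLerayHopfOn T ν 0 (u 0) u)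
    (hdec : HasRapidSpatialDecay (u 0)) :
    ∀ T' ∈ Ioo 0 T, ∃ V : ℝ, ∀ t ∈ Icc 0 T', ∀ x, ‖u t x‖ ≤ V := by
  intro T' hT'
  have hcl' : IsClassicalNSSolutionOn (Icc 0 T') ν 0 u p :=
    hcl.mono (Icc_subset_Ico_right hT'.2) (uniqueDiffOn_Icc hT'.1)
  have hEn : ∃ C : ℝ≥0∞, C < ⊤ ∧ ∀ t ∈ Icc 0 T', ∫⁻ x, ‖u t x‖ₑ ^ 2 ≤ C :=
    ⟨ENNReal.ofReal (2 * VectorCalculus.kineticEnergy (u 0)), ENNReal.ofReal_lt_top, fun t ht =>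
      hLH.lintegral_enorm_sq_le hν.le ⟨ht.1, ht.2.trans hT'.2.le⟩⟩
  have hH : HasBoundedSobolevNormsOn (Icc 0 T') u :=
    (tao2011_hasBoundedSobolevNormsOn.closedSlab tao2011_hasBoundedSobolevNormsOn_holds
      linfty_bound_of_hasBoundedSobolevNormsOn_holds ν T' hν hT'.1 u p hcl' hEn hdec).1
  exact linfty_bound_of_hasBoundedSobolevNormsOn_holds
    (fun t ht => (hcl'.contDiff_velocity ht).of_le (by norm_cast)) hH

/-- **No swirling (and only an axisymmetric) profile for an axisymmetric frozen-eddy collapse — in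
the exact hypotheses of the kill crux.** Let `ν > 0`, `T > 0`, `(u, p)` a classical solution of the
unforced Navier–Stokes system on `ℝ³ × [0, T)`, Leray–Hopf from the rapidly decaying datum `u 0`
(the hypotheses of `AdiabaticEddy.NoFrozenEddyCollapse`, stmt-NavierStokesRegularity-1431), whose
slices are AXISYMMETRIC about the `x₂`-axis.  If for some `α ∈ (1/2, 3/4)`, `ℓ > 0` and an ON-AXIS
centre path `ξ` the renormalised field `(T - t)^α • u t (ξ t + ℓ√(ν(T - t)) • y)` converges locally
uniformly to `U` as `t ↑ T`, then `U` is axisymmetric and swirl-free.  So in the axisymmetric class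
the frozen eddy of `FrozenEddyCollapse` (stmt-1430) can only be a swirl-free axisymmetric compactly
supported steady Euler flow — an object believed not to exist (Jiu–Xin, as quoted in
Domínguez-Vázquez–Enciso–Peralta-Salas, ARMA 2021, §1), which is the one remaining step of the
axisymmetric case of the kill.  Ingredients: swirl maximum principle (KNSS 2009 (1.9), Lei–Zhang 2017
(1.4): `abs_swirl_le_of_classical`), sub-slab boundedness (`bounded_subslab_of_lerayHopf`), and the
divergence of the circulation scale `A·L = (T - t)^{1/2-α} ℓ√ν`. [folklore] -/
theorem noSwirl_of_axisymmetric_frozenEddyCollapse {ν : ℝ} (hν : 0 < ν) {T : ℝ} (hT : 0 < T)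
    {u : ℝ → ℝ³ → ℝ³} {p : ℝ → ℝ³ → ℝ} (hcl : IsClassicalNSSolutionOn (Ico 0 T) ν 0 u p)
    (hLH : IsLerayHopfOn T ν 0 (u 0) u) (hdec : HasRapidSpatialDecay (u 0))
    (haxi : ∀ t ∈ Ico 0 T, IsAxisymmetric (u t))
    {U : ℝ³ → ℝ³} {α : ℝ} (hα : α ∈ Ioo (1 / 2 : ℝ) (3 / 4)) {ℓ : ℝ} (hℓ : 0 < ℓ)
    {ξ : ℝ → ℝ³} (hξ : ∀ t, ξ t 0 = 0 ∧ ξ t 1 = 0)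
    (hconv : TendstoLocallyUniformly
      (fun (t : ℝ) (y : ℝ³) => ((T - t) ^ α) • u t (ξ t + (ℓ * Real.sqrt (ν * (T - t))) • y)) U
      (𝓝[<] T)) :
    IsAxisymmetric U ∧ HasNoSwirl U :=
  axisymmetric_frozenEddy_profile hν hT hcl hdec haxi (bounded_subslab_of_lerayHopf hν hcl hLH hdec)
    hα hℓ hξ hconv

end Summit.NavierStokesRegularity.NavierStokesRegularity.Cruxes.FrozenEddyCollapse.LeadAll

end

/-!
# Compactly supported steady flows with straight streamlines, or with a missing direction, vanish

Two elementary rigidity lemmas for compactly supported fields, used by the axisymmetric analysis of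
the kill crux `AdiabaticEddy.NoFrozenEddyCollapse` (stmt-NavierStokesRegularity-1431) of route
AdiabaticEddy (off-axis centre paths, see `Cruxes/FrozenEddyCollapse/Lines/SketchIdeator1-dead.md`
§4.4) but stated in general:

* `eq_zero_of_convect_self_eq_zero` — **pressureless steady flows**: a compactly supported `C¹` field
  `U` on a finite-dimensional space with `(U·∇)U ≡ 0` vanishes.  Along the straight line
  `t ↦ x₀ + t U(x₀)` the defect `w(t) = U(x₀ + tU(x₀)) − U(x₀)` solves the linear ODE
  `w' = −DU(x₀ + tU(x₀)) w`, `w(0) = 0`, so `w ≡ 0` (Grönwall), i.e. the particle keeps the velocity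
  `U(x₀) ≠ 0` forever and leaves the support — contradiction.
* `eq_zero_of_steadyEuler_of_inner_eq_zero` — **steady Euler flows with a missing direction**: if a
  compactly supported `C¹` field `U` solves `(U·∇)U + ∇P = 0` with a differentiable pressure and
  `⟪U, e⟫ ≡ 0` for some `e ≠ 0`, then `U ≡ 0`: the `e`-component of the equation gives `∂ₑP ≡ 0`, so
  `∇P` is invariant under translation by `e` and vanishes far out along every `e`-line (where `U = 0`),
  hence `∇P ≡ 0` and the first lemma applies.  (No incompressibility is used.)
-/

noncomputable section

-- the summit-side namespace repeats a component by design (D-0017)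
set_option linter.dupNamespace false

namespace Summit.NavierStokesRegularity.NavierStokesRegularity.Cruxes.FrozenEddyCollapse.LeadAll

open Set Metric
open scoped InnerProductSpace
open Literature.Analysis.FluidPDE

/-- **A compactly supported `C¹` field with `(U·∇)U ≡ 0` vanishes** (straight streamlines run at
constant velocity cannot stay in a compact set).  Here `(U·∇)U (x) = DU(x)[U x]`
(`Literature.Analysis.FluidPDE.convect U U`). [folklore] -/
theorem eq_zero_of_convect_self_eq_zero {E : Type*} [NormedAddCommGroup E] [NormedSpace ℝ E]
    [FiniteDimensional ℝ E] {U : E → E} (hU : ContDiff ℝ 1 U) (hUc : HasCompactSupport U)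
    (h : ∀ x, fderiv ℝ U x (U x) = 0) : U = 0 := by
  -- a uniform bound on `DU`
  have hcontD : Continuous (fderiv ℝ U) := hU.continuous_fderiv one_ne_zero
  have hDc : HasCompactSupport (fderiv ℝ U) := hUc.fderiv (𝕜 := ℝ)
  obtain ⟨K, hK⟩ : ∃ K : ℝ, ∀ x, ‖fderiv ℝ U x‖ ≤ K := by
    obtain ⟨K, hK⟩ := (hDc.isCompact_range hcontD).isBounded.exists_norm_le
    exact ⟨K, fun x => hK _ (mem_range_self x)⟩
  -- the support lies in a ball
  obtain ⟨R, hR⟩ : ∃ R : ℝ, tsupport U ⊆ closedBall (0 : E) R :=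
    hUc.isCompact.isBounded.subset_closedBall 0
  have hdiff : Differentiable ℝ U := hU.differentiable one_ne_zero
  funext x₀
  by_contra hx₀
  simp only [Pi.zero_apply] at hx₀
  set v : E := U x₀ with hv
  have hvpos : 0 < ‖v‖ := norm_pos_iff.2 hx₀
  -- the defect along the straight line
  set w : ℝ → E := fun t => U (x₀ + t • v) - v with hw
  have hline : ∀ t, HasDerivAt (fun t : ℝ => x₀ + t • v) v t := fun t => by
    simpa using ((hasDerivAt_id t).smul_const v).const_add x₀
  have hderiv : ∀ t, HasDerivAt w (fderiv ℝ U (x₀ + t • v) v) t := fun t => by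
    have h1 : HasDerivAt (fun t : ℝ => U (x₀ + t • v)) (fderiv ℝ U (x₀ + t • v) v) t :=
      ((hdiff (x₀ + t • v)).hasFDerivAt.comp_hasDerivAt t (hline t))
    simpa [hw] using h1.sub_const v
  -- the linear ODE `w' = -DU w`
  have hkey : ∀ t, fderiv ℝ U (x₀ + t • v) v = -(fderiv ℝ U (x₀ + t • v) (w t)) := fun t => by
    simp only [hw, map_sub, h (x₀ + t • v), zero_sub, neg_neg]
  have hzero : ∀ b : ℝ, ∀ t ∈ Icc 0 b, w t = 0 := fun b =>
    eq_zero_of_abs_deriv_le_mul_abs_self_of_eq_zero_right (K := K)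
      (fun t _ => (hderiv t).continuousAt.continuousWithinAt)
      (fun t _ => (hderiv t).hasDerivWithinAt)
      (by simp [hw, hv])
      (fun t _ => by
        rw [hkey t, norm_neg]
        exact (ContinuousLinearMap.le_opNorm _ _).trans
          (mul_le_mul_of_nonneg_right (hK _) (norm_nonneg _)))
  -- far out along the line the field vanishes, yet it equals `v ≠ 0`
  set t₁ : ℝ := (|R| + ‖x₀‖ + 1) / ‖v‖ with ht₁
  have ht₁pos : 0 ≤ t₁ := by rw [ht₁]; positivity
  have hout : x₀ + t₁ • v ∉ tsupport U := by
    intro hmem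
    have h1 : ‖x₀ + t₁ • v‖ ≤ R := mem_closedBall_zero_iff.1 (hR hmem)
    have h2 : t₁ * ‖v‖ - ‖x₀‖ ≤ ‖x₀ + t₁ • v‖ := by
      have := norm_sub_norm_le (t₁ • v) (-x₀)
      rw [norm_smul, Real.norm_eq_abs, abs_of_nonneg ht₁pos, norm_neg, sub_neg_eq_add,
        add_comm] at this
      linarith
    have h3 : t₁ * ‖v‖ = |R| + ‖x₀‖ + 1 := by
      rw [ht₁, div_mul_cancel₀ _ hvpos.ne']
    linarith [le_abs_self R]
  have hUout : U (x₀ + t₁ • v) = 0 := image_eq_zero_of_notMem_tsupport hout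
  have hw1 : w t₁ = 0 := hzero t₁ t₁ ⟨ht₁pos, le_rfl⟩
  have : v = 0 := by
    have := hw1
    simp only [hw, hUout, zero_sub, neg_eq_zero] at this
    exact this
  exact hx₀ (by simpa [hv] using this)

/-- **A compactly supported steady Euler flow missing a direction vanishes.** Let `U` be a compactly
supported `C¹` field on a finite-dimensional inner product space and `P` a differentiable pressure
with `(U·∇)U + ∇P = 0` pointwise (`Literature.Analysis.FluidPDE.convect`, Mathlib `gradient`).  If
`⟪U x, e⟫ = 0` for all `x` and some `e ≠ 0`, then `U = 0`: the `e`-component of the equation is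
`∂ₑP = 0`, so `∇P (x + s • e) = ∇P x`; far along the `e`-line `U = 0`, so `∇P ≡ 0`, `(U·∇)U ≡ 0`, and
`eq_zero_of_convect_self_eq_zero` applies.  Incompressibility is not needed. [folklore] -/
theorem eq_zero_of_steadyEuler_of_inner_eq_zero {E : Type*} [NormedAddCommGroup E]
    [InnerProductSpace ℝ E] [FiniteDimensional ℝ E] {U : E → E} {P : E → ℝ}
    (hU : ContDiff ℝ 1 U) (hUc : HasCompactSupport U) (hP : Differentiable ℝ P)
    (hE : ∀ x, convect U U x + gradient P x = 0) {e : E} (he : e ≠ 0)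
    (hUe : ∀ x, ⟪U x, e⟫_ℝ = 0) : U = 0 := by
  have hdiff : Differentiable ℝ U := hU.differentiable one_ne_zero
  -- `⟪DU(x) w, e⟫ = 0`: differentiate the identity `⟪U ·, e⟫ ≡ 0`
  have hDe : ∀ x w, ⟪fderiv ℝ U x w, e⟫_ℝ = 0 := by
    intro x w
    have hcomp : ((innerSL ℝ e : E →L[ℝ] ℝ) ∘ U) = fun _ => (0 : ℝ) := by
      funext y
      have h := hUe y
      rw [real_inner_comm] at h
      simpa using h
    have h1 : HasFDerivAt ((innerSL ℝ e : E →L[ℝ] ℝ) ∘ U) ((innerSL ℝ e).comp (fderiv ℝ U x)) x :=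
      (innerSL ℝ e).hasFDerivAt.comp x (hdiff x).hasFDerivAt
    have h2 : HasFDerivAt ((innerSL ℝ e : E →L[ℝ] ℝ) ∘ U) (0 : E →L[ℝ] ℝ) x := by
      rw [hcomp]; exact hasFDerivAt_const 0 x
    have h3 := h1.unique h2
    have := congrArg (fun L : E →L[ℝ] ℝ => L w) h3
    simpa [real_inner_comm] using this
  -- `∂ₑ P ≡ 0`
  have hPe : ∀ x, fderiv ℝ P x e = 0 := by
    intro x
    have h1 : ⟪convect U U x + gradient P x, e⟫_ℝ = 0 := by rw [hE x, inner_zero_left]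
    rw [inner_add_left, convect, hDe, zero_add, gradient, InnerProductSpace.toDual_symm_apply] at h1
    exact h1
  -- `P` is invariant under translation by `e`
  have hPconst : ∀ x (s : ℝ), P (x + s • e) = P x := by
    intro x s
    have hl : ∀ r : ℝ, HasDerivAt (fun r : ℝ => x + r • e) e r := fun r => by
      simpa using ((hasDerivAt_id r).smul_const e).const_add x
    have hg := fun r : ℝ => (hP (x + r • e)).hasFDerivAt.comp_hasDerivAt r (hl r)
    have hconst := is_const_of_deriv_eq_zero (fun r => (hg r).differentiableAt)
      (fun r => by rw [(hg r).deriv, hPe]) s 0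
    simpa using hconst
  -- hence so is `∇P`
  have hgrad : ∀ x (s : ℝ), gradient P (x + s • e) = gradient P x := by
    intro x s
    have hfun : (fun y => P (y + s • e)) = P := funext fun y => hPconst y s
    have h1 : fderiv ℝ (fun y => P (y + s • e)) x = fderiv ℝ P (x + s • e) :=
      fderiv_comp_add_right (s • e)
    rw [hfun] at h1
    simp only [gradient, h1]
  -- far out along the `e`-line the field, hence `∇P`, vanishes
  obtain ⟨R, hR⟩ : ∃ R : ℝ, tsupport U ⊆ closedBall (0 : E) R :=
    hUc.isCompact.isBounded.subset_closedBall 0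
  have hepos : 0 < ‖e‖ := norm_pos_iff.2 he
  have hgrad0 : ∀ x, gradient P x = 0 := by
    intro x
    set s : ℝ := (|R| + ‖x‖ + 1) / ‖e‖ with hs
    have hspos : 0 ≤ s := by rw [hs]; positivity
    have hout : x + s • e ∉ tsupport U := by
      intro hmem
      have h1 : ‖x + s • e‖ ≤ R := mem_closedBall_zero_iff.1 (hR hmem)
      have h2 : s * ‖e‖ - ‖x‖ ≤ ‖x + s • e‖ := by
        have := norm_sub_norm_le (s • e) (-x)
        rw [norm_smul, Real.norm_eq_abs, abs_of_nonneg hspos, norm_neg, sub_neg_eq_add,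
          add_comm] at this
        linarith
      have h3 : s * ‖e‖ = |R| + ‖x‖ + 1 := by rw [hs, div_mul_cancel₀ _ hepos.ne']
      linarith [le_abs_self R]
    -- `U` vanishes on the open complement of its topological support, so `DU = 0` there too
    have hUz : U (x + s • e) = 0 := image_eq_zero_of_notMem_tsupport hout
    have hconv : convect U U (x + s • e) = 0 := by simp [convect, hUz]
    have := hE (x + s • e)
    rw [hconv, zero_add, hgrad x s] at this
    exact this
  -- so the flow is pressureless
  have hconv0 : ∀ x, fderiv ℝ U x (U x) = 0 := fun x => by
    have := hE x
    rwa [hgrad0 x, add_zero] at this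
  exact eq_zero_of_convect_self_eq_zero hU hUc hconv0

end Summit.NavierStokesRegularity.NavierStokesRegularity.Cruxes.FrozenEddyCollapse.LeadAll

end

/-!
# Axisymmetric frozen-eddy collapse with an OFF-AXIS centre: the profile vanishes (crux stmt-NavierStokesRegularity-1430 / kill stmt-1431)

Route AdiabaticEddy.  Companion of `AdiabaticEddyFrozenEddyAxisymNoSwirl` (on-axis centre ⇒ swirl-free
axisymmetric profile).  Here the centre path has a horizontal part converging to a NONZERO limit
`(ζ₀, ζ₁)`: then the swirl bound `|Γ| ≤ sup|Γ₀|` along `x = ξ(t) + L(t) y` gives, after multiplying by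
`(T - t)^α → 0`, `ζ₀ U₁(y) − ζ₁ U₀(y) = 0` for every `y`, i.e. `⟪U, e⟫ ≡ 0` with `e = (−ζ₁, ζ₀, 0) ≠ 0`,
and a compactly supported steady Euler flow missing a direction vanishes
(`eq_zero_of_steadyEuler_of_inner_eq_zero`).  Only `α > 0` is needed in this case.

* `horizontalCross_profile_eq_zero_of_axisymmetric` — the pointwise swirl consequence.
* `eq_zero_of_axisymmetric_frozenEddyCollapse_offAxis` — in the hypotheses of `NoFrozenEddyCollapse`
  + axisymmetric slices + centre path with convergent nonzero horizontal part: `U = 0`.  This CLOSES the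
  off-axis (convergent-centre) axisymmetric case of the kill crux stmt-NavierStokesRegularity-1431.
-/

noncomputable section

-- the summit-side namespace repeats a component by design (D-0017)
set_option linter.dupNamespace false

namespace Summit.NavierStokesRegularity.NavierStokesRegularity.Cruxes.FrozenEddyCollapse.LeadAll

open Filter Topology Set
open scoped InnerProductSpace
open Literature.Analysis.FluidPDE

local notation "ℝ³" => EuclideanSpace ℝ (Fin 3)

/-- **Off-axis swirl consequence (pointwise).** Classical solution on `[0, T)` (`ν > 0`, `T > 0`) with
axisymmetric slices, velocity bounded on closed sub-slabs and bounded initial swirl; if the horizontal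
components of the centre path converge, `ξ₀(t) → ζ₀`, `ξ₁(t) → ζ₁`, and
`(T - t)^α • u t (ξ t + (ℓ√(ν(T - t))) • y) → v` as `t ↑ T` with `α > 0`, then `ζ₀ v₁ − ζ₁ v₀ = 0`:
`(T - t)^α Γ(t, x_t) = (ξ₀ + L y₀) F₁ − (ξ₁ + L y₁) F₀ → ζ₀ v₁ − ζ₁ v₀` while `|Γ| ≤ M`. [folklore] -/
theorem horizontalCross_profile_eq_zero_of_axisymmetric {T ν α ℓ : ℝ} {u : ℝ → ℝ³ → ℝ³}
    {p : ℝ → ℝ³ → ℝ} (hν : 0 < ν) (hT : 0 < T) (hcl : IsClassicalNSSolutionOn (Ico 0 T) ν 0 u p)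
    (haxi : ∀ t ∈ Ico 0 T, IsAxisymmetric (u t))
    (hbdd : ∀ T' ∈ Ioo 0 T, ∃ V : ℝ, ∀ t ∈ Icc 0 T', ∀ x, ‖u t x‖ ≤ V)
    (hM : ∃ M : ℝ, ∀ x, |swirl (u 0) x| ≤ M) (hα : 0 < α)
    {ξ : ℝ → ℝ³} {ζ₀ ζ₁ : ℝ} (hξ₀ : Tendsto (fun t => ξ t 0) (𝓝[<] T) (𝓝 ζ₀))
    (hξ₁ : Tendsto (fun t => ξ t 1) (𝓝[<] T) (𝓝 ζ₁)) {y v : ℝ³}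
    (hconv : Tendsto (fun t => ((T - t) ^ α) • u t (ξ t + (ℓ * Real.sqrt (ν * (T - t))) • y))
      (𝓝[<] T) (𝓝 v)) :
    ζ₀ * v 1 - ζ₁ * v 0 = 0 := by
  obtain ⟨M, hM⟩ := hM
  have hΓ := abs_swirl_le_of_classical_Ico hν hcl haxi hbdd hM
  set L : ℝ → ℝ := fun t => ℓ * Real.sqrt (ν * (T - t)) with hL
  set x : ℝ → ℝ³ := fun t => ξ t + (L t) • y with hx
  set F : ℝ → ℝ³ := fun t => ((T - t) ^ α) • u t (x t) with hF
  set G : ℝ → ℝ := fun t => (ξ t 0 + L t * y 0) * F t 1 - (ξ t 1 + L t * y 1) * F t 0 with hG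
  have hswirl : ∀ t, (T - t) ^ α * swirl (u t) (x t) = G t := by
    intro t
    have hx0 : x t 0 = ξ t 0 + L t * y 0 := by
      simp only [hx, PiLp.add_apply, PiLp.smul_apply, smul_eq_mul]
    have hx1 : x t 1 = ξ t 1 + L t * y 1 := by
      simp only [hx, PiLp.add_apply, PiLp.smul_apply, smul_eq_mul]
    have hF0 : F t 0 = (T - t) ^ α * u t (x t) 0 := by simp only [hF, PiLp.smul_apply, smul_eq_mul]
    have hF1 : F t 1 = (T - t) ^ α * u t (x t) 1 := by simp only [hF, PiLp.smul_apply, smul_eq_mul]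
    simp only [swirl, hG, hx0, hx1, hF0, hF1]
    ring
  -- `L t → 0`
  have hLlim : Tendsto L (𝓝[<] T) (𝓝 0) := by
    have hc : Continuous L := by
      simp only [hL]
      exact continuous_const.mul (Real.continuous_sqrt.comp (continuous_const.mul
        (continuous_const.sub continuous_id)))
    have h' : Tendsto L (𝓝[<] T) (𝓝 (L T)) := (hc.tendsto T).mono_left nhdsWithin_le_nhds
    simpa [hL] using h'
  -- `G t → ζ₀ v₁ − ζ₁ v₀`
  have hconvF : Tendsto F (𝓝[<] T) (𝓝 v) := hconv
  have h1 : Tendsto (fun t => F t 1) (𝓝[<] T) (𝓝 (v 1)) :=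
    ((PiLp.continuous_apply 2 _ 1).tendsto v).comp hconvF
  have h0 : Tendsto (fun t => F t 0) (𝓝[<] T) (𝓝 (v 0)) :=
    ((PiLp.continuous_apply 2 _ 0).tendsto v).comp hconvF
  have hG1 : Tendsto G (𝓝[<] T) (𝓝 ((ζ₀ + 0 * y 0) * v 1 - (ζ₁ + 0 * y 1) * v 0)) :=
    ((hξ₀.add (hLlim.mul_const _)).mul h1).sub ((hξ₁.add (hLlim.mul_const _)).mul h0)
  simp only [zero_mul, add_zero] at hG1
  -- `G t → 0`
  have hG0 : Tendsto G (𝓝[<] T) (𝓝 0) := by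
    have hbound : ∀ᶠ t in 𝓝[<] T, ‖G t‖ ≤ M * (T - t) ^ α := by
      filter_upwards [Ico_mem_nhdsLT hT] with t ht
      have hTt : 0 < T - t := sub_pos.2 ht.2
      rw [Real.norm_eq_abs, ← hswirl t, abs_mul, abs_of_nonneg (Real.rpow_nonneg hTt.le α),
        mul_comm]
      exact mul_le_mul_of_nonneg_right (hΓ t ht (x t)) (Real.rpow_nonneg hTt.le α)
    have hlim : Tendsto (fun t => M * (T - t) ^ α) (𝓝[<] T) (𝓝 0) := by
      simpa using (tendsto_rpow_nhdsLT_zero (T := T) hα).const_mul M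
    exact squeeze_zero_norm' hbound hlim
  exact tendsto_nhds_unique hG1 hG0

/-- **Axisymmetric frozen-eddy collapse with an off-axis centre is impossible.** Let `ν > 0`, `T > 0`,
`(u, p)` a classical solution of the unforced Navier–Stokes system on `ℝ³ × [0, T)`, Leray–Hopf from the
rapidly decaying datum `u 0`, with AXISYMMETRIC slices; let `U` be a smooth compactly supported steady
Euler flow (pressure `P`) — the hypotheses of `AdiabaticEddy.NoFrozenEddyCollapse`
(stmt-NavierStokesRegularity-1431; incompressibility of `U` is not even needed).  If the renormalised
field `(T - t)^α • u t (ξ t + ℓ√(ν(T - t)) • y)` (`α > 0`) converges locally uniformly to `U` as `t ↑ T`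
along a centre path whose horizontal components converge to `(ζ₀, ζ₁) ≠ (0, 0)`, then `U = 0`.
Proof: `ζ₀ U₁ − ζ₁ U₀ ≡ 0` (`horizontalCross_profile_eq_zero_of_axisymmetric`, sub-slab bound from
`bounded_subslab_of_lerayHopf`), i.e. `⟪U, (−ζ₁, ζ₀, 0)⟫ ≡ 0`, and
`eq_zero_of_steadyEuler_of_inner_eq_zero`.  (In the axisymmetric class a singularity off the axis
would be a circle of singular points, excluded for suitable weak solutions by CKN; this is an
elementary route for the frozen-eddy scenario.) [folklore] -/
theorem eq_zero_of_axisymmetric_frozenEddyCollapse_offAxis {ν : ℝ} (hν : 0 < ν) {T : ℝ} (hT : 0 < T)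
    {u : ℝ → ℝ³ → ℝ³} {p : ℝ → ℝ³ → ℝ} (hcl : IsClassicalNSSolutionOn (Ico 0 T) ν 0 u p)
    (hLH : IsLerayHopfOn T ν 0 (u 0) u) (hdec : HasRapidSpatialDecay (u 0))
    (haxi : ∀ t ∈ Ico 0 T, IsAxisymmetric (u t))
    {U : ℝ³ → ℝ³} {P : ℝ³ → ℝ} (hU : ContDiff ℝ (⊤ : ℕ∞) U) (hP : ContDiff ℝ (⊤ : ℕ∞) P)
    (hUc : HasCompactSupport U) (hEul : ∀ x, convect U U x + gradient P x = 0)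
    {α : ℝ} (hα : 0 < α) {ℓ : ℝ} {ξ : ℝ → ℝ³} {ζ₀ ζ₁ : ℝ}
    (hξ₀ : Tendsto (fun t => ξ t 0) (𝓝[<] T) (𝓝 ζ₀))
    (hξ₁ : Tendsto (fun t => ξ t 1) (𝓝[<] T) (𝓝 ζ₁)) (hζ : ζ₀ ≠ 0 ∨ ζ₁ ≠ 0)
    (hconv : TendstoLocallyUniformly
      (fun (t : ℝ) (y : ℝ³) => ((T - t) ^ α) • u t (ξ t + (ℓ * Real.sqrt (ν * (T - t))) • y)) U
      (𝓝[<] T)) :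
    U = 0 := by
  have hbdd := bounded_subslab_of_lerayHopf hν hcl hLH hdec
  have hM := exists_abs_swirl_le_of_hasRapidSpatialDecay hdec
  have hcross : ∀ y, ζ₀ * U y 1 - ζ₁ * U y 0 = 0 := fun y =>
    horizontalCross_profile_eq_zero_of_axisymmetric hν hT hcl haxi hbdd hM hα hξ₀ hξ₁
      (hconv.tendstoLocallyUniformlyOn.tendsto_at (mem_univ y))
  set e : ℝ³ := WithLp.toLp 2 ![-ζ₁, ζ₀, 0] with he
  have he0 : e ≠ 0 := by
    intro h
    have h0 : e 0 = (0 : ℝ³) 0 := by rw [h]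
    have h1 : e 1 = (0 : ℝ³) 1 := by rw [h]
    simp [he] at h0 h1
    rcases hζ with h | h
    · exact h h1
    · exact h h0
  have hUe : ∀ x, ⟪U x, e⟫_ℝ = 0 := fun x => by
    have := hcross x
    simp [he, PiLp.inner_apply, Fin.sum_univ_three]
    linarith
  exact eq_zero_of_steadyEuler_of_inner_eq_zero (hU.of_le (by norm_cast)) hUc
    (hP.differentiable (by simp)) hEul he0 hUe

end Summit.NavierStokesRegularity.NavierStokesRegularity.Cruxes.FrozenEddyCollapse.LeadAll

end
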